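import Literature.MathematicalPhysics.QuantumFieldTheory.Balaban1983to89.B9Eq319QprimeTorus

/-!
# `Balaban1983to89.B9Eq343BlockPartitionOfUnity` — T. Bałaban, *Propagators for lattice gauge theories in a background field*, Commun. Math. Phys. **99** (1985)
# 389–434 [Balaban1985BackgroundPropagators] (3.43) p. 398 (*«ζ ∈ C₀^∞(Δ̃(y)), y ∈ Λ_j»* — the Hölder members of Thm 3.1 are LOCALISED BY SMOOTH CUTOFFS of the
# enlarged cubes), (3.40) p. 397 (the η-scale Hölder norms), with [Balaban1984PropagatorsII] (2.141) p. 247 (the random walk's partition of unity `h_□`) and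
# [Balaban1985Averaging] (2) p. 17 (the blocks `B(y)`): **A UNIT-SCALE LATTICE PARTITION OF UNITY SUBORDINATE TO THE BLOCKS OF THE FINE TORUS — `ζ_y(x) =
# Π_i p_{y_i}(x_i)`, `y ∈ T_m`, `x ∈ T_{(Km)}`, with `p_j = K⁻¹·(1_{B(j)}` summed over the `K` lattice shifts`)`: `Σ_y ζ_y ≡ 1` EXACTLY (every `m_i ≥ 1`, also one block
# per direction), `0 ≤ ζ_y ≤ 1`, `|ζ_y(x′) − ζ_y(x)| ≤ d·dist_{T_{(Km)}}(x,x′)∕K` (Lipschitz constant `d` at the unit scale `Kη = 1`, HEIGHT-FREE) and `ζ_y(x) ≠ 0 ⟹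
# dist_{T_m}(Π(x), y) ≤ 1`** — the localiser the Hölder junctions of STOREY H need (feeding print's block-localised Hölder letters (3.43)∕(3.44) with globally
# supported inputs, product rule at the unit scale); NE9 crux-team LEAF PROVER 01, gen 92

statement-level skeleton of published theorems with citation tags; proofs where landed; nothing here is a claim about the Yang–Mills mass gap

CITATION HEADER (lean-in-tree rule).  Audit cell `pub-balaban`, sub-cell `t4`, BINDER row NE9; filed by NE9 crux-team LEAF PROVER 01 (`b2b-balaban-t4-ne9-formalise-leaf-01`,
gen 92; bears_on: R4/N22).  Source READ first-hand this generation (`paper:balaban1985-cmp99-background-propagators`, journal page = PDF page + 388): p. 397 (3.39)–(3.41),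
p. 398 (3.43)–(3.45) («ζ ∈ C₀^∞(Δ̃(y))»).  Print takes ζ smooth and generic; THIS file fixes ONE concrete lattice family (averaged block indicators) — a MODEL CHOICE
of the cell, declared; the only properties used downstream are the five displayed ones.  Carriers BY NAME: `B4Sect5Torus.TSite ∕ tdist ∕ ccoord`,
`B9Eq319QprimeTorus.fineP ∕ blockCoord`, `B4TorusKernel.MultiPeriod.circAbs ∕ centre ∕ abs_add_mul_centre ∕ circAbs_le_abs ∕ circAbs_add_mul`; the scoped
`Fin.NatCast` ∕ `Fin.CommRing` instances of Mathlib for the modular arithmetic of `ℤ_{KM}`.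

WHAT IS DEFINED AND PROVED (sorry-free; definition lane — four `def`s with bodies, no `def … : Prop`, no `instance`, no notation; [folklore]).
* §1 (one dimension, `ℤ_{KM}`, `K, M ≥ 1`): `blockIndex` (`⌊k∕K⌋ ∈ ℤ_M`), `windowCount` (`W_j(k) = #{s < K : ⌊(k−s)∕K⌋ = j}`), `blockProfile` (`p_j = K⁻¹W_j`);
  `sum_windowCount` (`Σ_j W_j = K`), **`windowCount_succ_sub`** (one lattice step changes `W_j` by the two boundary indicators), `abs_windowCount_add_nat_sub_le`,
  **`abs_windowCount_sub_le_circAbs`** (`|W_j(k′) − W_j(k)| ≤ dist(k′−k, KMℤ)` along the shorter arc), **`blockIndex_add_natCast_of_lt`** (a shift by `s < K` moves the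
  block index by `0` or `1` mod `M`, wrap-around included), `blockIndex_of_windowCount_ne_zero`, **`circAbs_blockIndex_sub_le_one`**; `blockProfile_nonneg ∕ _le_one`,
  **`sum_blockProfile`** (`Σ_j p_j ≡ 1`), **`abs_blockProfile_sub_le`**.
* §2 (the fine torus `T_{(Km)}`): `abs_prod_sub_prod_le`; **`blockPartition`** `ζ_y(x) = Π_i p_{y_i}(x_i)`; **`sum_blockPartition`** (`Σ_y ζ_y ≡ 1`,
  `Finset.prod_univ_sum`), `blockPartition_nonneg ∕ _le_one`, **`abs_blockPartition_sub_le`** (`≤ d·tdist∕K`), **`tdist_blockCoord_le_one_of_blockPartition_ne_zero`**;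
  **`exists_blockPartition`** (the five properties packaged `∃`-first for the row files).
HONEST SCOPE.  Elementary lattice combinatorics; NO propagator, NO estimate of [B9]; the Hölder letters (3.43)₂∕(3.44) of Thm 3.1 and their junction with the third word
of `𝔊̃_k` (this lineage's G-1∕G-3, `B9Eq3152GtildeThirdWordTwoSided` ∕ `B11Eq117FrakGkPiTransformationNorm`) are NOT here; «NE9 ⇐ the named binders»; NE9 NOT PRINTED ∕
NOT PROVED; row WALLED ON A MODEL (O-NE9-1; #5 UNRULED); spine PROVED 0∕9; rung (B)+1 on a finite T⁴ — NOT infinite volume, NOT mass gap, NOT BetaPertH, NOT Clay.  HONEST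
DEPENDENCY: continuum YM on T⁴ ⇐ BetaPertH ∧ nine spine estimates (0/9 proved); BetaPertH ⇐ (D1) ∧ (D4) ∧ CAP+tail; G-an2-4 gates asym, D1 and NE2/3/4.  NEW file importing
`B9Eq319QprimeTorus` only; nothing modified.  Net new unproved facts: 0.
-/

noncomputable section

set_option autoImplicit false

open scoped BigOperators

namespace Literature.MathematicalPhysics.QuantumFieldTheory.Balaban1983to89.B9Eq343BlockPartitionOfUnity

open Fin.NatCast Fin.CommRing
open B4Sect5Torus (TSite tdist ccoord)
open B4TorusKernel.MultiPeriod (circAbs centre abs_add_mul_centre circAbs_nonneg)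
open B9Eq319QprimeTorus (fineP blockCoord)

/-! ## §1 One dimension: the averaged block indicator on `ℤ_{KM}` -/

section OneDim

variable (K M : ℕ) [NeZero K] [NeZero M]

/-- **The block index** `x ↦ ⌊x∕K⌋ ∈ ℤ_M` of a point of the one-dimensional fine torus `ℤ_{KM}` ([B7] (2): the block `B(y) = {x : yK ≦ x < yK + K}`).
[cite: Balaban1985Averaging, (2) p.17] -/
def blockIndex (k : Fin (K * M)) : Fin M := ⟨(k : ℕ) / K, Nat.div_lt_of_lt_mul k.isLt⟩

/-- **The window count** `W_j(k) = #{0 ≤ s < K : ⌊(k − s)∕K⌋ = j}` — the number of points of the block `B(j)` in the window `{k − K + 1, …, k}` of the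
one-dimensional fine torus (the indicator of `B(j)` averaged over `K` shifts, times `K`). [folklore] [cite: Balaban1985BackgroundPropagators, (3.43) p.398] -/
def windowCount (j : Fin M) (k : Fin (K * M)) : ℝ :=
  ∑ s ∈ Finset.range K, if blockIndex K M (k - (s : Fin (K * M))) = j then (1 : ℝ) else 0

/-- **The one-dimensional block profile** `p_j(k) = K⁻¹·W_j(k)` — the indicator of the block `B(j)` averaged over the `K` shifts `0, …, K − 1`: a lattice
tent of height `1` on `B(j)`, supported in `B(j) ∪ B(j+1)`, with slopes `±K⁻¹`; `Σ_j p_j ≡ 1` for EVERY number of blocks `M ≥ 1`. [folklore]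
[cite: Balaban1985BackgroundPropagators, (3.43) p.398] -/
def blockProfile (j : Fin M) (k : Fin (K * M)) : ℝ := (K : ℝ)⁻¹ * windowCount K M j k

/-- `0 ≤ W_j(k)`. [folklore] -/
private theorem windowCount_nonneg (j : Fin M) (k : Fin (K * M)) : 0 ≤ windowCount K M j k :=
  Finset.sum_nonneg fun _ _ => by split_ifs <;> norm_num

/-- `W_j(k) ≤ K`. [folklore] -/
private theorem windowCount_le (j : Fin M) (k : Fin (K * M)) : windowCount K M j k ≤ K := by
  unfold windowCount
  calc _ ≤ ∑ _s ∈ Finset.range K, (1 : ℝ) := Finset.sum_le_sum fun _ _ => by split_ifs <;> norm_num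
    _ = K := by simp

/-- `Σ_j W_j(k) = K`: every point of the window lies in exactly one block. [folklore] [cite: Balaban1985BackgroundPropagators, (3.43) p.398] -/
theorem sum_windowCount (k : Fin (K * M)) : ∑ j, windowCount K M j k = K := by
  unfold windowCount
  rw [Finset.sum_comm]
  simp [Finset.sum_ite_eq]

/-- **One lattice step**: `W_j(k+1) − W_j(k) = [⌊(k+1)∕K⌋ = j] − [⌊(k+1−K)∕K⌋ = j]` — the window gains the point `k + 1` and loses `k + 1 − K`. [folklore]
[cite: Balaban1985BackgroundPropagators, (3.43) p.398] -/
theorem windowCount_succ_sub (j : Fin M) (k : Fin (K * M)) :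
    windowCount K M j (k + 1) - windowCount K M j k =
      (if blockIndex K M (k + 1) = j then (1 : ℝ) else 0) - (if blockIndex K M (k + 1 - (K : Fin (K * M))) = j then (1 : ℝ) else 0) := by
  obtain ⟨K', rfl⟩ : ∃ K', K = K' + 1 := Nat.exists_eq_succ_of_ne_zero (NeZero.ne K)
  unfold windowCount
  rw [Finset.sum_range_succ' _ K', Finset.sum_range_succ _ K']
  have e : ∀ s : ℕ, k + 1 - (((s + 1 : ℕ)) : Fin ((K' + 1) * M)) = k - (s : Fin ((K' + 1) * M)) := by
    intro s; push_cast; abel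
  simp only [e, Nat.cast_zero, sub_zero]
  ring

/-- `|W_j(k+1) − W_j(k)| ≤ 1`. [folklore] -/
private theorem abs_windowCount_succ_sub_le (j : Fin M) (k : Fin (K * M)) : |windowCount K M j (k + 1) - windowCount K M j k| ≤ 1 := by
  rw [windowCount_succ_sub]
  split_ifs <;> norm_num

/-- `|W_j(k+N) − W_j(k)| ≤ N` (`N` lattice steps). [folklore] -/
private theorem abs_windowCount_add_nat_sub_le (j : Fin M) (k : Fin (K * M)) (N : ℕ) : |windowCount K M j (k + (N : Fin (K * M))) - windowCount K M j k| ≤ N := by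
  induction N with
  | zero => simp
  | succ N ih =>
    have e : k + ((N + 1 : ℕ) : Fin (K * M)) = (k + (N : Fin (K * M))) + 1 := by push_cast; ring
    rw [e]
    calc _ = |(windowCount K M j (k + (N : Fin (K * M)) + 1) - windowCount K M j (k + (N : Fin (K * M)))) + (windowCount K M j (k + (N : Fin (K * M))) - windowCount K M j k)| := by ring_nf
      _ ≤ |windowCount K M j (k + (N : Fin (K * M)) + 1) - windowCount K M j (k + (N : Fin (K * M)))| + |windowCount K M j (k + (N : Fin (K * M))) - windowCount K M j k| := abs_add_le _ _
      _ ≤ 1 + N := add_le_add (abs_windowCount_succ_sub_le K M j _) ih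
      _ = (N + 1 : ℕ) := by push_cast; ring

/-- **The circular Lipschitz letter** `|W_j(k′) − W_j(k)| ≤ dist(k′ − k, KMℤ)`: walk from `k` to `k′` along the shorter arc (the centred representative
`t = (k′ − k) + KM·centre` of `B4TorusKernel.MultiPeriod.abs_add_mul_centre`, `|t| = circAbs`). [folklore] [cite: Balaban1985BackgroundPropagators, (3.43) p.398] -/
theorem abs_windowCount_sub_le_circAbs (j : Fin M) (k k' : Fin (K * M)) :
    |windowCount K M j k' - windowCount K M j k| ≤ circAbs (K * M) (((k' : ℕ) : ℤ) - ((k : ℕ) : ℤ)) := by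
  have hP : 1 ≤ K * M := Nat.one_le_iff_ne_zero.2 (NeZero.ne _)
  set z : ℤ := ((k' : ℕ) : ℤ) - ((k : ℕ) : ℤ) with hz
  set t : ℤ := z + (K * M : ℕ) * centre (K * M) z with ht
  have habs : |t| = circAbs (K * M) z := abs_add_mul_centre hP z
  -- `k′ = k + t` in `Fin (K*M)`
  have hcast : ((t : ℤ) : Fin (K * M)) = k' - k := by
    rw [ht, hz]
    have h0 : ((K * M : ℕ) : Fin (K * M)) = 0 := Fin.natCast_self (K * M)
    push_cast at h0 ⊢
    rw [h0, zero_mul, add_zero]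
  have hN : ((t.natAbs : ℕ) : ℝ) = ((circAbs (K * M) z : ℤ) : ℝ) := by
    rw [← habs, ← Int.natCast_natAbs, Int.cast_natCast]
  rcases Int.natAbs_eq t with h | h
  · -- t = natAbs t ≥ 0: k' = k + N
    have hk' : k' = k + ((t.natAbs : ℕ) : Fin (K * M)) := by
      have : ((t : ℤ) : Fin (K * M)) = ((t.natAbs : ℕ) : Fin (K * M)) := by
        conv_lhs => rw [h]
        exact Int.cast_natCast _
      rw [← this, hcast]; abel
    rw [hk']
    exact (abs_windowCount_add_nat_sub_le K M j k t.natAbs).trans hN.le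
  · -- t = -natAbs t: k = k' + N
    have hk : k = k' + ((t.natAbs : ℕ) : Fin (K * M)) := by
      have : ((t : ℤ) : Fin (K * M)) = -((t.natAbs : ℕ) : Fin (K * M)) := by
        conv_lhs => rw [h]
        rw [Int.cast_neg, Int.cast_natCast]
      have h2 : -(((t.natAbs : ℕ) : Fin (K * M))) = k' - k := by rw [← this, hcast]
      have h3 : k = k' + ((t.natAbs : ℕ) : Fin (K * M)) := by
        have := congrArg (fun w => k' - w) h2
        simp only [sub_neg_eq_add, sub_sub_cancel] at this
        exact this.symm
      exact h3
    rw [abs_sub_comm, hk]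
    exact (abs_windowCount_add_nat_sub_le K M j k' t.natAbs).trans hN.le


/-- **A shift by `s < K` moves the block index by at most one**: `⌊(u + s)∕K⌋ = ⌊u∕K⌋` or `⌊u∕K⌋ + 1` in `ℤ_M` (the wrap-around `u + s ≥ KM` forces `⌊u∕K⌋ = M − 1`
and the new index `0 = (M − 1) + 1`). [folklore] [cite: Balaban1985Averaging, (2) p.17] -/
theorem blockIndex_add_natCast_of_lt (u : Fin (K * M)) {s : ℕ} (hs : s < K) :
    blockIndex K M (u + (s : Fin (K * M))) = blockIndex K M u ∨ blockIndex K M (u + (s : Fin (K * M))) = blockIndex K M u + 1 := by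
  have hK : 0 < K := Nat.pos_of_ne_zero (NeZero.ne K)
  have hM : 0 < M := Nat.pos_of_ne_zero (NeZero.ne M)
  have hKM : K ≤ K * M := Nat.le_mul_of_pos_right K hM
  have hsval : ((s : Fin (K * M)) : ℕ) = s := Fin.val_cast_of_lt (hs.trans_le hKM)
  set q : ℕ := (u : ℕ) / K with hq
  set r : ℕ := (u : ℕ) % K with hr
  have hu : (u : ℕ) = K * q + r := (Nat.div_add_mod (u : ℕ) K).symm
  have hrK : r < K := Nat.mod_lt _ hK
  have hqM : q < K * M / K := Nat.div_lt_div_of_lt_of_dvd (Dvd.intro _ rfl) u.isLt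
  rw [Nat.mul_div_cancel_left M hK] at hqM
  have hblku : (blockIndex K M u : ℕ) = q := rfl
  have hval : ((u + (s : Fin (K * M)) : Fin (K * M)) : ℕ) = ((u : ℕ) + s) % (K * M) := by rw [Fin.val_add, hsval]
  -- `(r + s) / K ∈ {0, 1}`
  have hrs : (r + s) / K ≤ 1 := Nat.lt_succ_iff.1 ((Nat.div_lt_iff_lt_mul hK).2 (by omega))
  by_cases hwrap : (u : ℕ) + s < K * M
  · -- no wrap-around
    have hval' : ((u + (s : Fin (K * M)) : Fin (K * M)) : ℕ) = K * q + (r + s) := by rw [hval, Nat.mod_eq_of_lt hwrap, hu, add_assoc]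
    have hdiv : ((u + (s : Fin (K * M)) : Fin (K * M)) : ℕ) / K = q + (r + s) / K := by
      rw [hval', Nat.mul_add_div hK]
    have hblk : (blockIndex K M (u + (s : Fin (K * M))) : ℕ) = q + (r + s) / K := hdiv
    rcases Nat.le_one_iff_eq_zero_or_eq_one.1 hrs with h0 | h1
    · left; ext; rw [hblk, hblku, h0, add_zero]
    · right
      have hlt : q + 1 < M := by
        have := (blockIndex K M (u + (s : Fin (K * M)))).isLt; rw [hblk, h1] at this; exact this
      have e1 : blockIndex K M u + 1 = ((q + 1 : ℕ) : Fin M) := by rw [Nat.cast_succ, ← hblku, Fin.cast_val_eq_self]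
      rw [e1]; ext; rw [hblk, h1, Fin.val_cast_of_lt hlt]
  · -- wrap-around: the sum crosses `K·M`; then `q = M − 1` and the new block is `0`
    push Not at hwrap
    have hlt2 : (u : ℕ) + s < K * M + K := by have := u.isLt; omega
    have hval' : ((u + (s : Fin (K * M)) : Fin (K * M)) : ℕ) = (u : ℕ) + s - K * M := by
      rw [hval, Nat.mod_eq_sub_mod hwrap, Nat.mod_eq_of_lt (by omega)]
    have hsmall : (u : ℕ) + s - K * M < K := by omega
    have hblk0 : (blockIndex K M (u + (s : Fin (K * M))) : ℕ) = 0 := by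
      show ((u + (s : Fin (K * M)) : Fin (K * M)) : ℕ) / K = 0
      rw [hval']; exact Nat.div_eq_of_lt hsmall
    -- `q = M − 1`: from `K·q + r + s ≥ K·M` with `r + s < 2K`
    have hq1 : q + 1 = M := by
      have h1 : K * M ≤ K * q + (r + s) := by rw [hu] at hwrap; omega
      have h2 : K * M < K * (q + 2) := by nlinarith
      have h3 : M < q + 2 := Nat.lt_of_mul_lt_mul_left h2
      omega
    right
    have e1 : blockIndex K M u + 1 = ((q + 1 : ℕ) : Fin M) := by rw [Nat.cast_succ, ← hblku, Fin.cast_val_eq_self]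
    rw [e1, hq1, Fin.natCast_self]; ext; rw [hblk0]; rfl

/-- **Support of the window count**: `W_j(k) ≠ 0 ⟹ ⌊k∕K⌋ ∈ {j, j + 1}` (mod `M`). [folklore] [cite: Balaban1985BackgroundPropagators, (3.43) p.398] -/
theorem blockIndex_of_windowCount_ne_zero (j : Fin M) (k : Fin (K * M)) (h : windowCount K M j k ≠ 0) :
    blockIndex K M k = j ∨ blockIndex K M k = j + 1 := by
  obtain ⟨s, hs, hne⟩ := Finset.exists_ne_zero_of_sum_ne_zero h
  have hsK : s < K := Finset.mem_range.1 hs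
  have hb : blockIndex K M (k - (s : Fin (K * M))) = j := by
    by_contra hc; exact hne (if_neg hc)
  have e : k = (k - (s : Fin (K * M))) + (s : Fin (K * M)) := by abel
  rcases blockIndex_add_natCast_of_lt K M (k - (s : Fin (K * M))) hsK with h0 | h1
  · left; rw [e, h0, hb]
  · right; rw [e, h1, hb]

/-- **Support, in the coarse torus distance**: `W_j(k) ≠ 0 ⟹ dist(⌊k∕K⌋ − j, Mℤ) ≤ 1`. [folklore] [cite: Balaban1985BackgroundPropagators, (3.43) p.398] -/
theorem circAbs_blockIndex_sub_le_one (j : Fin M) (k : Fin (K * M)) (h : windowCount K M j k ≠ 0) :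
    circAbs M (((blockIndex K M k : ℕ) : ℤ) - ((j : ℕ) : ℤ)) ≤ 1 := by
  have hM : 1 ≤ M := Nat.one_le_iff_ne_zero.2 (NeZero.ne M)
  rcases blockIndex_of_windowCount_ne_zero K M j k h with h0 | h1
  · rw [h0, sub_self, B4Sect5Torus.circAbs_zero]; norm_num
  · -- `blk k = j + 1`: the difference is `1` or `1 − M`
    rcases eq_or_lt_of_le (Nat.succ_le_of_lt j.isLt) with hjM | hjM
    · -- `j + 1 = M`: then `j + 1 = 0` in `Fin M`
      have e1 : j + 1 = ((((j : ℕ) + 1 : ℕ)) : Fin M) := by rw [Nat.cast_succ, Fin.cast_val_eq_self]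
      rw [h1, e1, show (j : ℕ) + 1 = M from hjM, Fin.natCast_self, Fin.val_zero]
      have e : ((0 : ℕ) : ℤ) - ((j : ℕ) : ℤ) = 1 + (M : ℤ) * (-1) := by
        have : ((j : ℕ) : ℤ) + 1 = M := by exact_mod_cast hjM
        push_cast; linarith
      rw [e, B4TorusKernel.MultiPeriod.circAbs_add_mul]
      exact (B4TorusKernel.MultiPeriod.circAbs_le_abs hM 1).trans (by norm_num)
    · have e1 : j + 1 = ((((j : ℕ) + 1 : ℕ)) : Fin M) := by rw [Nat.cast_succ, Fin.cast_val_eq_self]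
      rw [h1, e1, Fin.val_cast_of_lt hjM]
      have e : ((((j : ℕ) + 1 : ℕ)) : ℤ) - ((j : ℕ) : ℤ) = 1 := by push_cast; ring
      rw [e]
      exact (B4TorusKernel.MultiPeriod.circAbs_le_abs hM 1).trans (by norm_num)

/-- `0 ≤ p_j(k)` (the cutoff is nonnegative). [folklore] [cite: Balaban1985BackgroundPropagators, (3.43) p.398] -/
theorem blockProfile_nonneg (j : Fin M) (k : Fin (K * M)) : 0 ≤ blockProfile K M j k :=
  mul_nonneg (inv_nonneg.2 (Nat.cast_nonneg K)) (windowCount_nonneg K M j k)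

/-- `p_j(k) ≤ 1` (the cutoff is normalised). [folklore] [cite: Balaban1985BackgroundPropagators, (3.43) p.398] -/
theorem blockProfile_le_one (j : Fin M) (k : Fin (K * M)) : blockProfile K M j k ≤ 1 := by
  have hK : (0 : ℝ) < K := Nat.cast_pos.2 (Nat.pos_of_ne_zero (NeZero.ne K))
  unfold blockProfile
  rw [inv_mul_le_iff₀ hK, mul_one]
  exact windowCount_le K M j k

/-- **`Σ_j p_j(k) = 1` — a partition of unity on the one-dimensional fine torus, for EVERY `M ≥ 1`.** [folklore] [cite: Balaban1985BackgroundPropagators, (3.43) p.398] -/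
theorem sum_blockProfile (k : Fin (K * M)) : ∑ j, blockProfile K M j k = 1 := by
  have hK : (K : ℝ) ≠ 0 := Nat.cast_ne_zero.2 (NeZero.ne K)
  unfold blockProfile
  rw [← Finset.mul_sum, sum_windowCount, inv_mul_cancel₀ hK]

/-- **`|p_j(k′) − p_j(k)| ≤ dist(k′ − k, KMℤ)∕K` — the profile is `K⁻¹`-Lipschitz per lattice step along the torus** (= `1`-Lipschitz at the unit scale `Kη = 1`).
[folklore] [cite: Balaban1985BackgroundPropagators, (3.43) p.398, (3.40) p.397] -/
theorem abs_blockProfile_sub_le (j : Fin M) (k k' : Fin (K * M)) :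
    |blockProfile K M j k' - blockProfile K M j k| ≤ (circAbs (K * M) (((k' : ℕ) : ℤ) - ((k : ℕ) : ℤ)) : ℝ) / K := by
  have hK : (0 : ℝ) < K := Nat.cast_pos.2 (Nat.pos_of_ne_zero (NeZero.ne K))
  unfold blockProfile
  rw [← mul_sub, abs_mul, abs_of_pos (inv_pos.2 hK), inv_mul_eq_div, div_le_div_iff_of_pos_right hK]
  exact abs_windowCount_sub_le_circAbs K M j k k'

end OneDim

/-! ## §2 The partition of unity on the fine torus `T_{(Km)}` -/

section Torus

variable {d : ℕ} (K : ℕ) [NeZero K] (m : Fin d → ℕ) [∀ i, NeZero (m i)]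

/-- `|Π_i a_i − Π_i b_i| ≤ Σ_i |a_i − b_i|` for real factors of absolute value at most one. [folklore] -/
private theorem abs_prod_sub_prod_le (s : Finset (Fin d)) (a b : Fin d → ℝ) (ha : ∀ i, |a i| ≤ 1) (hb : ∀ i, |b i| ≤ 1) :
    |∏ i ∈ s, a i - ∏ i ∈ s, b i| ≤ ∑ i ∈ s, |a i - b i| := by
  classical
  induction s using Finset.induction_on with
  | empty => simp
  | insert i s hi ih =>
    rw [Finset.prod_insert hi, Finset.prod_insert hi, Finset.sum_insert hi]
    have hPb : |∏ i ∈ s, b i| ≤ 1 := by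
      rw [Finset.abs_prod]; exact Finset.prod_le_one (fun _ _ => abs_nonneg _) (fun i _ => hb i)
    calc |a i * ∏ i ∈ s, a i - b i * ∏ i ∈ s, b i| = |a i * (∏ i ∈ s, a i - ∏ i ∈ s, b i) + (a i - b i) * ∏ i ∈ s, b i| := by ring_nf
      _ ≤ |a i * (∏ i ∈ s, a i - ∏ i ∈ s, b i)| + |(a i - b i) * ∏ i ∈ s, b i| := abs_add_le _ _
      _ = |a i| * |∏ i ∈ s, a i - ∏ i ∈ s, b i| + |a i - b i| * |∏ i ∈ s, b i| := by rw [abs_mul, abs_mul]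
      _ ≤ 1 * |∏ i ∈ s, a i - ∏ i ∈ s, b i| + |a i - b i| * 1 :=
          add_le_add (mul_le_mul_of_nonneg_right (ha i) (abs_nonneg _)) (mul_le_mul_of_nonneg_left hPb (abs_nonneg _))
      _ ≤ |a i - b i| + ∑ i ∈ s, |a i - b i| := by linarith

/-- **THE BLOCK PARTITION OF UNITY** `ζ_y(x) = Π_i p_{y_i}(x_i)` on the fine torus `T_{(Km)}` indexed by the blocks `y ∈ T_m`: print's smooth cutoffs
`ζ ∈ C₀^∞(Δ̃(y))`, `h_□` of the random-walk localisation, realised on the lattice with unit-scale Lipschitz control and an EXACT sum `Σ_y ζ_y ≡ 1`.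
[cite: Balaban1985BackgroundPropagators, (3.43) p.398, (3.40) p.397; Balaban1984PropagatorsII, (2.141) p.247] -/
def blockPartition (y : TSite d m) (x : TSite d (fineP K m)) : ℝ := ∏ i, blockProfile K (m i) (y i) (x i)

/-- **`Σ_y ζ_y(x) = 1`** (the product of the one-dimensional partitions of unity, `Finset.prod_univ_sum`). [folklore]
[cite: Balaban1985BackgroundPropagators, (3.43) p.398] -/
theorem sum_blockPartition (x : TSite d (fineP K m)) : ∑ y, blockPartition K m y x = 1 := by
  classical
  unfold blockPartition
  have h := Finset.prod_univ_sum (fun _ : Fin d => (Finset.univ : Finset (Fin _))) fun i j => blockProfile K (m i) j (x i)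
  rw [Fintype.piFinset_univ] at h
  rw [← h]
  exact Finset.prod_eq_one fun i _ => sum_blockProfile K (m i) (x i)

/-- `0 ≤ ζ_y(x)` (the cutoff is nonnegative). [folklore] [cite: Balaban1985BackgroundPropagators, (3.43) p.398] -/
theorem blockPartition_nonneg (y : TSite d m) (x : TSite d (fineP K m)) : 0 ≤ blockPartition K m y x :=
  Finset.prod_nonneg fun i _ => blockProfile_nonneg K (m i) (y i) (x i)

/-- `ζ_y(x) ≤ 1` (the cutoff is normalised, `|ζ| ≤ 1`). [folklore] [cite: Balaban1985BackgroundPropagators, (3.43) p.398] -/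
theorem blockPartition_le_one (y : TSite d m) (x : TSite d (fineP K m)) : blockPartition K m y x ≤ 1 :=
  Finset.prod_le_one (fun i _ => blockProfile_nonneg K (m i) (y i) (x i)) fun i _ => blockProfile_le_one K (m i) (y i) (x i)

/-- **THE UNIT-SCALE LIPSCHITZ LETTER `|ζ_y(x′) − ζ_y(x)| ≤ d·dist_{T_{(Km)}}(x, x′)∕K`** — at spacing `η = K⁻¹` this is `d·|x − x′|` in the η-scale sup-distance of (3.40):
the cutoff's Hölder∕Lipschitz constant is height-free. [folklore] [cite: Balaban1985BackgroundPropagators, (3.40) p.397, (3.43) p.398] -/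
theorem abs_blockPartition_sub_le (y : TSite d m) (x x' : TSite d (fineP K m)) :
    |blockPartition K m y x' - blockPartition K m y x| ≤ d * tdist (fineP K m) x x' / K := by
  have hP : ∀ i, 1 ≤ fineP K m i := fun i => Nat.one_le_iff_ne_zero.2 (Nat.mul_ne_zero (NeZero.ne K) (NeZero.ne (m i)))
  have hK : (0 : ℝ) < K := Nat.cast_pos.2 (Nat.pos_of_ne_zero (NeZero.ne K))
  unfold blockPartition
  refine (abs_prod_sub_prod_le Finset.univ _ _ (fun i => ?_) (fun i => ?_)).trans ?_
  · rw [abs_of_nonneg (blockProfile_nonneg K (m i) _ _)]; exact blockProfile_le_one K (m i) _ _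
  · rw [abs_of_nonneg (blockProfile_nonneg K (m i) _ _)]; exact blockProfile_le_one K (m i) _ _
  calc ∑ i, |blockProfile K (m i) (y i) (x' i) - blockProfile K (m i) (y i) (x i)| ≤ ∑ _i : Fin d, tdist (fineP K m) x x' / K :=
        Finset.sum_le_sum fun i _ => (abs_blockProfile_sub_le K (m i) (y i) (x i) (x' i)).trans
          (div_le_div_of_nonneg_right (by
            have := B4Sect5Torus.circAbs_le_tdist hP x' x i
            rw [B4Sect5Torus.tdist_symm hP] at this
            exact this) hK.le)
    _ = d * tdist (fineP K m) x x' / K := by simp [Finset.sum_const, mul_div_assoc]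

/-- **SUPPORT: `ζ_y(x) ≠ 0 ⟹ dist_{T_m}(Π(x), y) ≤ 1`** — the cutoff of the block `y` lives on the `3^d` blocks around `y` (print's enlarged cube `Δ̃(y)`).
[folklore] [cite: Balaban1985BackgroundPropagators, (3.43) p.398] -/
theorem tdist_blockCoord_le_one_of_blockPartition_ne_zero (hm : ∀ i, 1 ≤ m i) (y : TSite d m) (x : TSite d (fineP K m))
    (hne : blockPartition K m y x ≠ 0) : tdist m (blockCoord K m x) y ≤ 1 := by
  have hne' : ∀ i, windowCount K (m i) (y i) (x i) ≠ 0 := by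
    intro i hz
    apply hne
    exact Finset.prod_eq_zero (Finset.mem_univ i) (by unfold blockProfile; rw [hz, mul_zero])
  unfold tdist
  have h1 : Finset.univ.sup (ccoord m (blockCoord K m x) y) ≤ 1 := by
    refine Finset.sup_le fun i _ => ?_
    have hc := B4Sect5Torus.ccoord_cast hm (blockCoord K m x) y i
    have hb : (((blockCoord K m x i).val : ℤ)) = ((blockIndex K (m i) (x i) : ℕ) : ℤ) := rfl
    have := circAbs_blockIndex_sub_le_one K (m i) (y i) (x i) (hne' i)
    rw [← hb, ← hc] at this
    exact_mod_cast this
  exact_mod_cast h1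

/-- **THE BLOCK PARTITION OF UNITY, PACKAGED** (`∃`-form for row files): a family `ζ_y`, `y ∈ T_m`, on `T_{(Km)}` with `Σ_y ζ_y ≡ 1`, `0 ≤ ζ_y ≤ 1`, the unit-scale
Lipschitz letter `|ζ_y(x′) − ζ_y(x)| ≤ d·dist(x, x′)∕K` and support in the blocks at coarse distance `≤ 1` from `y`. [folklore]
[cite: Balaban1985BackgroundPropagators, (3.43) p.398, (3.40) p.397] -/
theorem exists_blockPartition (hm : ∀ i, 1 ≤ m i) :
    ∃ ζ : TSite d m → TSite d (fineP K m) → ℝ,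
      (∀ x, ∑ y, ζ y x = 1) ∧ (∀ y x, 0 ≤ ζ y x) ∧ (∀ y x, ζ y x ≤ 1) ∧
      (∀ y x x', |ζ y x' - ζ y x| ≤ d * tdist (fineP K m) x x' / K) ∧
      (∀ y x, ζ y x ≠ 0 → tdist m (blockCoord K m x) y ≤ 1) :=
  ⟨blockPartition K m, sum_blockPartition K m, blockPartition_nonneg K m, blockPartition_le_one K m, abs_blockPartition_sub_le K m,
    tdist_blockCoord_le_one_of_blockPartition_ne_zero K m hm⟩

end Torus

end Literature.MathematicalPhysics.QuantumFieldTheory.Balaban1983to89.B9Eq343BlockPartitionOfUnity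

end
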